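import Mathlib
import Literature.MathematicalPhysics.QuantumLattice.FinDimSpectrumGibbsLimitProofs
import Literature.Computability.AlgebraicComplexity.QuantumFunctionalsDegenerationProofs
import HarnessLib

/-!
# Route BalabanIR — crux 4 `BirGappedPhaseReduction` (item `stmt-HubbardSuperconductivity-2082`):
# the spectral TRANSFER inequality (time extent `M₁ ↦ M ≥ M₁ ↦ ∞` at fixed volume)

Step (3) of the reduction (`β → ∞` at fixed even `L` is `M → ∞` time slices at fixed `L`) asks the
engine for slice order UNIFORMLY in the time extent `M ≥ L`, including `M ≫ L²` — the regime the
refuters single out (Beraha–Kahane–Weiss zeros of `tr T^M`; `Cruxes/BirComplexStableXY/Disproof.lean`).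
When the slice transfer operator `T` is POSITIVE semidefinite (reflection positivity in time — the
free structure of the Hubbard side, `Tr e^{-aH}`; cf. `…BirGappedPhaseReductionTimeRP.lean`), no
uniformity in `M` is needed: slice expectations `r(M) = tr(T^M O)/tr(T^M)` of an observable
`0 ≤ O ≤ 1` are convex combinations of FIXED diagonal entries with weights `∝ λᵢ^M` that concentrate
on the top eigenspace, and order proved at ONE extent `M₁` transfers to every `M ≥ M₁` and to
`M = ∞` (the ground-eigenspace average the target `BirGroundStateAverageLRO` is about) through a
single scalar, the DOUBLING PARTICIPATION NUMBER `N(M₁) = (tr T^{M₁})² / tr T^{2M₁} ≥ 1`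
(two partition functions, aspect ratios `M₁/L` and `2M₁/L`):

* `spectralTransfer_doubling` — for `T.PosSemidef`, `T ≠ 0`, `O.PosSemidef`, `(1 - O).PosSemidef`,
  `M₁ ≤ M`: **`r(M) ≥ 1/N(M₁) − (1 − r(M₁))`**, i.e. `(1 − (1 − r(M₁))·N(M₁))/N(M₁) ≤ r(M)`
  (`spectralTransfer_doubling'`, the form of the crux-idea card `rp-tau-spectral-transfer`);
* the `M = ∞` end (ground-eigenspace average versus ONE Gibbs state, with the better constant
  `1 − (1 − ⟨O⟩_β)·Z(β)²/Z(2β)`) is in the companion file `…SpectralTransferGround.lean`.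

Proofs: spectral theorem (`Matrix.IsHermitian.spectral_theorem`), `T^K = U diag(λᵢ^K) U⋆`
(`tr T^K = Σ λᵢ^K` is reused from `Literature.Computability.AlgebraicComplexity`),
`tr(T^K O) = Σ λᵢ^K õᵢ` with `õᵢ = (U⋆OU)ᵢᵢ ∈ [0,1]`, and four one-line inequalities on
nonnegative reals (`spectralTransfer_core`): with `λ₀ = max λᵢ`,
`tr T^{2M₁} ≤ λ₀^{M₁} tr T^{M₁}`, `tr T^{M₁} − tr(T^{M₁}O) ≥ λ₀^{M₁}(1 − õ₀)`,
`tr T^M ≤ λ₀^{M−M₁} tr T^{M₁}`, `tr(T^M O) ≥ λ₀^M õ₀`.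

No definition is introduced; the file is `Theses`-free (Mathlib + Literature `FinDimSpectrum`).
References: M. Reed, B. Simon I, Thm VII.2 (functional calculus); H. Tasaki (2020) App. A
(ground states as `β → ∞` limits); the participation number is the inverse of the collision
probability `Σ pᵢ²` of the weights `pᵢ ∝ λᵢ^{M₁}`. [folklore]
-/

noncomputable section

namespace Summit.HubbardSuperconductivity.HubbardSuperconductivity.Theorems

open Matrix Literature.MathematicalPhysics.QuantumLattice
open Literature.Computability.AlgebraicComplexity (trace_pow_eq_sum_eigenvalues_pow
  sum_eigenvalues_pow_eq_re_trace_pow)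
open scoped Matrix.Norms.L2Operator ComplexOrder MatrixOrder InnerProductSpace

variable {n : Type*} [Fintype n] [DecidableEq n]

/-! ### An elementary inequality on nonnegative weights -/

/-- Core real inequality behind the spectral transfer: for weights `w ≥ 0` with a maximal index
`i₀`, `w i₀ > 0`, marks `o ∈ [0,1]` and `M₁ ≤ M`,
`(Σ w^{2M₁})/(Σ w^{M₁})² − (1 − (Σ w^{M₁} o)/(Σ w^{M₁})) ≤ (Σ w^M o)/(Σ w^M)`. [folklore] -/
theorem spectralTransfer_core {ι : Type*} [Fintype ι] {w o : ι → ℝ} (hw : ∀ i, 0 ≤ w i)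
    (ho0 : ∀ i, 0 ≤ o i) (ho1 : ∀ i, o i ≤ 1) {i₀ : ι} (hmax : ∀ i, w i ≤ w i₀) (hpos : 0 < w i₀)
    {M₁ M : ℕ} (hM : M₁ ≤ M) :
    (∑ i, w i ^ (2 * M₁)) / (∑ i, w i ^ M₁) ^ 2 - (1 - (∑ i, w i ^ M₁ * o i) / ∑ i, w i ^ M₁)
      ≤ (∑ i, w i ^ M * o i) / ∑ i, w i ^ M := by
  set A := ∑ i, w i ^ M₁ with hA
  set A2 := ∑ i, w i ^ (2 * M₁) with hA2
  set B := ∑ i, w i ^ M₁ * o i with hB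
  set aM := ∑ i, w i ^ M with haM
  set bM := ∑ i, w i ^ M * o i with hbM
  have hApos : 0 < A :=
    lt_of_lt_of_le (pow_pos hpos M₁)
      (Finset.single_le_sum (f := fun i => w i ^ M₁) (fun i _ => pow_nonneg (hw i) _)
        (Finset.mem_univ i₀))
  have haMpos : 0 < aM :=
    lt_of_lt_of_le (pow_pos hpos M)
      (Finset.single_le_sum (f := fun i => w i ^ M) (fun i _ => pow_nonneg (hw i) _)
        (Finset.mem_univ i₀))
  -- (i) `A2 ≤ w₀^{M₁} A`
  have h1 : A2 ≤ w i₀ ^ M₁ * A := by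
    rw [hA, Finset.mul_sum]
    refine Finset.sum_le_sum fun i _ => ?_
    rw [two_mul, pow_add]
    exact mul_le_mul_of_nonneg_right (pow_le_pow_left₀ (hw i) (hmax i) M₁) (pow_nonneg (hw i) _)
  -- (ii) `w₀^{M₁} (1 - o₀) ≤ A - B`
  have h2 : w i₀ ^ M₁ * (1 - o i₀) ≤ A - B := by
    have hAB : A - B = ∑ i, w i ^ M₁ * (1 - o i) := by
      rw [hA, hB, ← Finset.sum_sub_distrib]
      exact Finset.sum_congr rfl fun i _ => by ring
    rw [hAB]
    exact Finset.single_le_sum (f := fun i => w i ^ M₁ * (1 - o i))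
      (fun i _ => mul_nonneg (pow_nonneg (hw i) _) (sub_nonneg.2 (ho1 i))) (Finset.mem_univ i₀)
  -- (iii) `aM ≤ w₀^{M-M₁} A`
  have h3 : aM ≤ w i₀ ^ (M - M₁) * A := by
    rw [hA, Finset.mul_sum]
    refine Finset.sum_le_sum fun i _ => ?_
    calc w i ^ M = w i ^ (M - M₁) * w i ^ M₁ := by rw [← pow_add, Nat.sub_add_cancel hM]
      _ ≤ w i₀ ^ (M - M₁) * w i ^ M₁ :=
        mul_le_mul_of_nonneg_right (pow_le_pow_left₀ (hw i) (hmax i) _) (pow_nonneg (hw i) _)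
  -- (iv) `w₀^M o₀ ≤ bM`
  have h4 : w i₀ ^ M * o i₀ ≤ bM :=
    Finset.single_le_sum (f := fun i => w i ^ M * o i)
      (fun i _ => mul_nonneg (pow_nonneg (hw i) _) (ho0 i)) (Finset.mem_univ i₀)
  -- the left-hand side is at most `w₀^{M₁} o₀ / A` …
  have hL : A2 / A ^ 2 - (1 - B / A) ≤ w i₀ ^ M₁ * o i₀ / A := by
    have e1 : A2 / A ^ 2 ≤ w i₀ ^ M₁ / A := by
      rw [div_le_div_iff₀ (by positivity) hApos]
      calc A2 * A ≤ w i₀ ^ M₁ * A * A := mul_le_mul_of_nonneg_right h1 hApos.le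
        _ = w i₀ ^ M₁ * A ^ 2 := by ring
    have e2 : 1 - B / A = (A - B) / A := by
      field_simp
    have e3 : w i₀ ^ M₁ * (1 - o i₀) / A ≤ (A - B) / A := div_le_div_of_nonneg_right h2 hApos.le
    calc A2 / A ^ 2 - (1 - B / A) ≤ w i₀ ^ M₁ / A - w i₀ ^ M₁ * (1 - o i₀) / A := by
          rw [e2]; linarith
      _ = w i₀ ^ M₁ * o i₀ / A := by ring
  -- … and the right-hand side is at least `w₀^{M₁} o₀ / A`
  have hR : w i₀ ^ M₁ * o i₀ / A ≤ bM / aM := by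
    rw [div_le_div_iff₀ hApos haMpos]
    calc w i₀ ^ M₁ * o i₀ * aM ≤ w i₀ ^ M₁ * o i₀ * (w i₀ ^ (M - M₁) * A) :=
          mul_le_mul_of_nonneg_left h3 (mul_nonneg (pow_nonneg hpos.le _) (ho0 i₀))
      _ = w i₀ ^ M * o i₀ * A := by
          rw [show w i₀ ^ M = w i₀ ^ (M - M₁) * w i₀ ^ M₁ by
            rw [← pow_add, Nat.sub_add_cancel hM]]
          ring
      _ ≤ bM * A := mul_le_mul_of_nonneg_right h4 hApos.le
  exact hL.trans hR

/-! ### Powers and traces of a Hermitian matrix in its eigenbasis -/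

/-- `T ^ K = U diag(λᵢ ^ K) U⋆` in the eigenbasis of a Hermitian `T`
(`Matrix.IsHermitian.spectral_theorem`). [folklore] -/
theorem isHermitian_pow_eq_conj_diagonal {T : Matrix n n ℂ} (hT : T.IsHermitian) (K : ℕ) :
    T ^ K = (hT.eigenvectorUnitary : Matrix n n ℂ) *
      diagonal (fun i => ((hT.eigenvalues i : ℝ) : ℂ) ^ K) *
        star (hT.eigenvectorUnitary : Matrix n n ℂ) := by
  conv_lhs => rw [hT.spectral_theorem]
  rw [← map_pow, diagonal_pow, Unitary.conjStarAlgAut_apply]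
  rfl

/-- `tr (U diag(d) V · O) = Σᵢ dᵢ (V O U)ᵢᵢ` (cyclicity of the trace). [folklore] -/
theorem trace_conj_diagonal_mul (U V : Matrix n n ℂ) (d : n → ℂ) (O : Matrix n n ℂ) :
    (U * diagonal d * V * O).trace = ∑ i, d i * (V * O * U) i i := by
  have h : (U * diagonal d * V * O).trace = (diagonal d * (V * O * U)).trace := by
    rw [Matrix.mul_assoc, Matrix.mul_assoc, trace_mul_comm]
    simp only [Matrix.mul_assoc]
  rw [h, Matrix.trace]
  refine Finset.sum_congr rfl fun i _ => ?_
  simp only [Matrix.diag_apply, diagonal_mul]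

/-- `tr (T^K O) = Σᵢ λᵢ^K · (U⋆ O U)ᵢᵢ` for a Hermitian `T` with eigenbasis `U`. [folklore] -/
theorem trace_pow_mul_eq_sum_eigenvalues_pow {T : Matrix n n ℂ} (hT : T.IsHermitian) (K : ℕ) (O : Matrix n n ℂ) :
    (T ^ K * O).trace = ∑ i, ((hT.eigenvalues i : ℝ) : ℂ) ^ K *
      (star (hT.eigenvectorUnitary : Matrix n n ℂ) * O * (hT.eigenvectorUnitary : Matrix n n ℂ)) i i := by
  rw [isHermitian_pow_eq_conj_diagonal hT K, trace_conj_diagonal_mul]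

/-- Real parts: `re tr (T^K O) = Σᵢ λᵢ^K · re (U⋆ O U)ᵢᵢ`. [folklore] -/
theorem re_trace_pow_mul_eq_sum_eigenvalues_pow {T : Matrix n n ℂ} (hT : T.IsHermitian) (K : ℕ) (O : Matrix n n ℂ) :
    (T ^ K * O).trace.re = ∑ i, (hT.eigenvalues i) ^ K *
      ((star (hT.eigenvectorUnitary : Matrix n n ℂ) * O *
        (hT.eigenvectorUnitary : Matrix n n ℂ)) i i).re := by
  rw [trace_pow_mul_eq_sum_eigenvalues_pow hT K O, Complex.re_sum]
  refine Finset.sum_congr rfl fun i _ => ?_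
  rw [← Complex.ofReal_pow, Complex.re_ofReal_mul]

/-! ### Diagonal entries of `U⋆ O U` for `0 ≤ O ≤ 1` -/

omit [DecidableEq n] in
/-- For `O ⪰ 0` and any `U`, the diagonal entries of `U⋆ O U` have nonnegative real part.
[folklore] -/
theorem re_conj_apply_self_nonneg {O : Matrix n n ℂ} (hO : O.PosSemidef) (U : Matrix n n ℂ)
    (i : n) : 0 ≤ ((star U * O * U) i i).re := by
  have h : (star U * O * U).PosSemidef := by
    rw [Matrix.star_eq_conjTranspose]
    exact hO.conjTranspose_mul_mul_same U
  exact (Complex.nonneg_iff.1 (h.diag_nonneg (i := i))).1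

/-- For `O ⪯ 1` and `U⋆ U = 1`, the diagonal entries of `U⋆ O U` have real part at most `1`.
[folklore] -/
theorem re_conj_apply_self_le_one {O : Matrix n n ℂ} (hO1 : (1 - O).PosSemidef) {U : Matrix n n ℂ}
    (hU : star U * U = 1) (i : n) : ((star U * O * U) i i).re ≤ 1 := by
  have h : (star U * (1 - O) * U).PosSemidef := by
    rw [Matrix.star_eq_conjTranspose]
    exact hO1.conjTranspose_mul_mul_same U
  have h2 : star U * (1 - O) * U = 1 - star U * O * U := by
    rw [Matrix.mul_sub, Matrix.sub_mul, Matrix.mul_one, hU]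
  rw [h2] at h
  have h3 := (Complex.nonneg_iff.1 (h.diag_nonneg (i := i))).1
  rw [Matrix.sub_apply, Matrix.one_apply_eq, Complex.sub_re, Complex.one_re] at h3
  linarith

/-! ### The spectral transfer inequality -/

/-- **Spectral transfer by a doubling participation number.** For a positive semidefinite
transfer matrix `T ≠ 0`, an observable `0 ≤ O ≤ 1` and time extents `M₁ ≤ M`, with
`r(K) = re tr(T^K O) / re tr(T^K)` and `N(M₁) = (re tr T^{M₁})² / re tr T^{2M₁}`:
`1/N(M₁) − (1 − r(M₁)) ≤ r(M)`. Order at ONE extent `M₁` plus two partition functions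
(`M₁`, `2M₁`) bound the order at every larger extent — the monotone bookkeeping that replaces
uniformity in `M` when the slice transfer operator is reflection positive. [folklore] -/
theorem spectralTransfer_doubling {T O : Matrix n n ℂ} (hT : T.PosSemidef) (hT0 : T ≠ 0)
    (hO : O.PosSemidef) (hO1 : (1 - O).PosSemidef) {M₁ M : ℕ} (hM : M₁ ≤ M) :
    (T ^ (2 * M₁)).trace.re / (T ^ M₁).trace.re ^ 2 -
        (1 - (T ^ M₁ * O).trace.re / (T ^ M₁).trace.re)
      ≤ (T ^ M * O).trace.re / (T ^ M).trace.re := by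
  have hH : T.IsHermitian := hT.1
  set U : Matrix n n ℂ := (hH.eigenvectorUnitary : Matrix n n ℂ) with hUdef
  have hU : star U * U = 1 := Unitary.coe_star_mul_self hH.eigenvectorUnitary
  set w : n → ℝ := hH.eigenvalues with hw
  set o : n → ℝ := fun i => ((star U * O * U) i i).re with ho
  have hwnn : ∀ i, 0 ≤ w i := fun i => hT.eigenvalues_nonneg i
  have ho0 : ∀ i, 0 ≤ o i := fun i => re_conj_apply_self_nonneg hO U i
  have ho1 : ∀ i, o i ≤ 1 := fun i => re_conj_apply_self_le_one hO1 hU i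
  -- a maximal eigenvalue, positive since `T ≠ 0`
  have hex : ∃ i, w i ≠ 0 := by
    by_contra hall
    push Not at hall
    exact hT0 (hH.eigenvalues_eq_zero_iff.1 (funext hall))
  obtain ⟨j, hj⟩ := hex
  have hne : (Finset.univ : Finset n).Nonempty := ⟨j, Finset.mem_univ j⟩
  obtain ⟨i₀, -, hi₀⟩ := Finset.exists_max_image Finset.univ w hne
  have hmax : ∀ i, w i ≤ w i₀ := fun i => hi₀ i (Finset.mem_univ i)
  have hpos : 0 < w i₀ := lt_of_lt_of_le (lt_of_le_of_ne (hwnn j) (Ne.symm hj)) (hmax j)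
  rw [← sum_eigenvalues_pow_eq_re_trace_pow hH, ← sum_eigenvalues_pow_eq_re_trace_pow hH,
    ← sum_eigenvalues_pow_eq_re_trace_pow hH, re_trace_pow_mul_eq_sum_eigenvalues_pow hH,
    re_trace_pow_mul_eq_sum_eigenvalues_pow hH]
  exact spectralTransfer_core hwnn ho0 ho1 hmax hpos hM

/-- The same inequality in the shape of the crux-idea card `rp-tau-spectral-transfer`
(`Cruxes/BirGroundStateAverageLRO/Ideas/`): with `r K := re (tr(T^K O)/tr(T^K))` and
`N := (re tr T^{M₁})² / re tr T^{2M₁}`, `(1 − (1 − r M₁)·N)/N ≤ r M`. [folklore] -/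
theorem spectralTransfer_doubling' {T O : Matrix n n ℂ} (hT : T.PosSemidef) (hT0 : T ≠ 0)
    (hO : O.PosSemidef) (hO1 : (1 - O).PosSemidef) {M₁ M : ℕ} (hM : M₁ ≤ M) :
    (1 - (1 - ((T ^ M₁ * O).trace / (T ^ M₁).trace).re) *
        ((T ^ M₁).trace.re ^ 2 / (T ^ (2 * M₁)).trace.re)) /
        ((T ^ M₁).trace.re ^ 2 / (T ^ (2 * M₁)).trace.re)
      ≤ ((T ^ M * O).trace / (T ^ M).trace).re := by
  have hH : T.IsHermitian := hT.1
  -- the traces `tr T^K` are real and positive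
  have hreal : ∀ K, (T ^ K).trace = ((T ^ K).trace.re : ℂ) := by
    intro K
    rw [← sum_eigenvalues_pow_eq_re_trace_pow hH K, trace_pow_eq_sum_eigenvalues_pow hH K]
    push_cast
    rfl
  have hex : ∃ i, hH.eigenvalues i ≠ 0 := by
    by_contra hall
    push Not at hall
    exact hT0 (hH.eigenvalues_eq_zero_iff.1 (funext hall))
  obtain ⟨j, hj⟩ := hex
  have hposK : ∀ K, 0 < (T ^ K).trace.re := by
    intro K
    rw [← sum_eigenvalues_pow_eq_re_trace_pow hH K]
    exact lt_of_lt_of_le (pow_pos (lt_of_le_of_ne (hT.eigenvalues_nonneg j) (Ne.symm hj)) K)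
      (Finset.single_le_sum (f := fun i => hH.eigenvalues i ^ K)
        (fun i _ => pow_nonneg (hT.eigenvalues_nonneg i) _) (Finset.mem_univ j))
  have hdiv : ∀ K, ((T ^ K * O).trace / (T ^ K).trace).re =
      (T ^ K * O).trace.re / (T ^ K).trace.re := by
    intro K
    rw [hreal K, Complex.div_ofReal_re, Complex.ofReal_re]
  have hmain := spectralTransfer_doubling hT hT0 hO hO1 hM
  rw [hdiv, hdiv]
  set N := (T ^ M₁).trace.re ^ 2 / (T ^ (2 * M₁)).trace.re with hN
  have hNpos : 0 < N := by
    rw [hN]; exact div_pos (pow_pos (hposK M₁) 2) (hposK (2 * M₁))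
  have e : (1 - (1 - (T ^ M₁ * O).trace.re / (T ^ M₁).trace.re) * N) / N =
      1 / N - (1 - (T ^ M₁ * O).trace.re / (T ^ M₁).trace.re) := by
    field_simp
  rw [e, hN, one_div_div]
  exact hmain

end Summit.HubbardSuperconductivity.HubbardSuperconductivity.Theorems
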